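import Summits.BirchSwinnertonDyer.Rank1Residual.Additive.CondExpFourUnitPartLawThreeOfTableII
import HarnessLib

/-!
# The rows of Rizzo's Table II with `v(N) ∈ {3, 5}` (the DICYCLIC wild cell at `3`), read on
# invariants: the middle Kraus entry `v₃(c₆)` per Kodaira type

Cell `pub/bsd-wall` (D-0145 line `route-BirchSwinnertonDyer-CyclotomicUntwist`), seat `bsd-line-cycu-p2`
(prover seat 2/3, gen 3). TABLE LAYER of the companion file `…WildThreeShapeLawDicyclic.lean`, which proves
the `v₃N ∈ {3, 5}` rows of the O6 SHAPE LAW `@[conjecture] WildThreeResidualShapeByKodaira` and, with this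
seat's `…WildThreeShapeLawRowFour.lean`, DISCHARGES that node. THEOREMS ONLY (pure case analysis of the
typed transcription `Rizzo.tableII`; no definition, no named fact, no `sorry`); BSD is not proved by this
file and no crux is. Pattern = cc-typer-5 / b2b `rizzo_tableII_condExp_eq_four`,
`rows_of_condExpOfInvariants_eq_four` (`Additive/CondExpFourUnitPartLawThreeOfTableII.lean`).

* `rizzo_tableII_condExp_eq_three`: the seven `v(N) = 3` rows are `(≥2,3,3)` (II, generic), `(2,4,3)`
  (II, special), `(2,3,5)` (IV), `(4,6,9)` / `(≥5,6,9)` (IV*, generic), `(4,7,9)` (IV*, special),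
  `(4,6,11)` (II*) — recorded as `(b, c)` with `a` on the two special rows;
* `rizzo_tableII_condExp_eq_five`: the four `v(N) = 5` rows are `★(≥2,2,1)` (II*, shift `1`: `(≥6,8,13)`),
  `(≥3,4,5)` (II), `(≥4,5,7)` (IV), `(≥5,7,11)` (IV*);
* `rows_of_condExpOfInvariants_eq_three/five`: on invariants `c₄, c₆, Δ ∈ ℚ` with `v₃Δ` in the
  Papadopoulos window the shift is solved for and `(v₃c₆, v₃Δ)` is pinned (with `v₃c₄` on the special rows).
References: O. Rizzo, Compositio Math. 136 (2003) 1–23, Table II (p. 4), §1.1–1.2 [Rizzo2003];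
A. Kraus, Manuscripta Math. 69 (1990), Théorème (p = 3) [Kraus1990].
-/

set_option autoImplicit false
-- single-conjunct summit: `Summit.BirchSwinnertonDyer.BirchSwinnertonDyer.…` repeats the name by design
set_option linter.dupNamespace false

noncomputable section

open scoped Classical

open WeierstrassCurve Literature.NumberTheory.EllipticCurves

namespace Summit.BirchSwinnertonDyer.BirchSwinnertonDyer.Theorems.PSLocalThreeTorsion

/-! ## §1 The rows of Table II with `v(N) = 3` and `v(N) = 5` -/

section Table

/-- Projection `.2` commutes with `if`. [folklore] -/
private theorem snd_ite' {α β : Type*} (P : Prop) [Decidable P] (x y : α × β) :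
    (if P then x else y).2 = if P then x.2 else y.2 := by
  split <;> rfl

/-- Projection `.1` commutes with `if`. [folklore] -/
private theorem fst_ite' {α β : Type*} (P : Prop) [Decidable P] (x y : α × β) :
    (if P then x else y).1 = if P then x.1 else y.1 := by
  split <;> rfl

/-- One step of the `if`-cascade. [folklore] -/
private theorem ite_eq_peel {α : Type*} {P : Prop} [Decidable P] {x y n : α}
    (h : (if P then x else y) = n) : (P ∧ x = n) ∨ (¬ P ∧ y = n) := by
  by_cases hP : P
  · exact Or.inl ⟨hP, by rwa [if_pos hP] at h⟩
  · exact Or.inr ⟨hP, by rwa [if_neg hP] at h⟩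

/-- One step of the `if`-cascade past a row whose value is not the target. [folklore] -/
private theorem ite_eq_peel_ne {α : Type*} {P : Prop} [Decidable P] {x y n : α} (hx : x ≠ n)
    (h : (if P then x else y) = n) : y = n := by
  rcases ite_eq_peel h with ⟨-, h⟩ | ⟨-, h⟩
  · exact absurd h hx
  · exact h

/-- **The seven rows of Rizzo's Table II whose conductor column reads `v(N) = 3`**, on the reduced triple
`(a, b, c)`: `(≥2,3,3)` II, `(2,4,3)` II, `(2,3,5)` IV, `(4,6,9)` / `(≥5,6,9)` IV*, `(4,7,9)` IV*, `(4,6,11)` II* —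
recorded by `(b, c)`, with `a` on the two special rows `(2,4,3)`, `(4,7,9)`. Pure case analysis of the
transcription. [cite: Rizzo2003, Table II (p. 4), column v(N)] -/
theorem rizzo_tableII_condExp_eq_three {a b : WithTop ℤ} {c c4' c6' Δ' : ℤ}
    (h : (Rizzo.tableII a b c c4' c6' Δ').2.1 = 3) :
    (b = 3 ∧ c = 3) ∨ (a = 2 ∧ b = 4 ∧ c = 3) ∨ (b = 3 ∧ c = 5) ∨ (b = 6 ∧ c = 9) ∨
      (a = 4 ∧ b = 7 ∧ c = 9) ∨ (b = 6 ∧ c = 11) := by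
  unfold Rizzo.tableII at h
  dsimp only at h
  simp only [snd_ite', fst_ite'] at h
  replace h := ite_eq_peel_ne (by decide) h
  replace h := ite_eq_peel_ne (by decide) h
  replace h := ite_eq_peel_ne (by decide) h
  replace h := ite_eq_peel_ne (by decide) h
  replace h := ite_eq_peel_ne (by decide) h
  -- (≥2, 3, 3), generic: II
  obtain ⟨hc, -⟩ | ⟨-, h⟩ := ite_eq_peel h
  · exact Or.inl ⟨hc.2.1, hc.2.2.1⟩
  replace h := ite_eq_peel_ne (by decide) h
  -- (2, 4, 3): II
  obtain ⟨hc, -⟩ | ⟨-, h⟩ := ite_eq_peel h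
  · exact Or.inr (Or.inl hc)
  replace h := ite_eq_peel_ne (by decide) h
  replace h := ite_eq_peel_ne (by decide) h
  -- (2, 3, 5): IV
  obtain ⟨hc, -⟩ | ⟨-, h⟩ := ite_eq_peel h
  · exact Or.inr (Or.inr (Or.inl ⟨hc.2.1, hc.2.2⟩))
  replace h := ite_eq_peel_ne (by decide) h
  replace h := ite_eq_peel_ne (by decide) h
  replace h := ite_eq_peel_ne (by decide) h
  replace h := ite_eq_peel_ne (by decide) h
  replace h := ite_eq_peel_ne (by decide) h
  replace h := ite_eq_peel_ne (by decide) h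
  -- (4, 6, 9), c₆'² + 2 ≢ 3c_{4,4}: IV*
  obtain ⟨hc, -⟩ | ⟨-, h⟩ := ite_eq_peel h
  · exact Or.inr (Or.inr (Or.inr (Or.inl ⟨hc.2.1, hc.2.2.1⟩)))
  -- (≥5, 6, 9): IV*
  obtain ⟨hc, -⟩ | ⟨-, h⟩ := ite_eq_peel h
  · exact Or.inr (Or.inr (Or.inr (Or.inl ⟨hc.2.1, hc.2.2.1⟩)))
  -- (4, 7, 9): IV*
  obtain ⟨hc, -⟩ | ⟨-, h⟩ := ite_eq_peel h
  · exact Or.inr (Or.inr (Or.inr (Or.inr (Or.inl hc))))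
  replace h := ite_eq_peel_ne (by decide) h
  replace h := ite_eq_peel_ne (by decide) h
  -- (4, 6, 11): II*
  obtain ⟨hc, -⟩ | ⟨-, h⟩ := ite_eq_peel h
  · exact Or.inr (Or.inr (Or.inr (Or.inr (Or.inr ⟨hc.2.1, hc.2.2⟩))))
  replace h := ite_eq_peel_ne (by decide) h
  exact absurd h (by decide)

/-- **The four rows of Rizzo's Table II whose conductor column reads `v(N) = 5`**, on the reduced triple:
`★(≥2,2,1)` II* (minimal only after the shift `m = 1`: `(≥6,8,13)`), `(≥3,4,5)` II, `(≥4,5,7)` IV,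
`(≥5,7,11)` IV* — recorded by `(b, c)`. [cite: Rizzo2003, Table II (p. 4), column v(N)] -/
theorem rizzo_tableII_condExp_eq_five {a b : WithTop ℤ} {c c4' c6' Δ' : ℤ}
    (h : (Rizzo.tableII a b c c4' c6' Δ').2.1 = 5) :
    (b = 2 ∧ c = 1) ∨ (b = 4 ∧ c = 5) ∨ (b = 5 ∧ c = 7) ∨ (b = 7 ∧ c = 11) := by
  unfold Rizzo.tableII at h
  dsimp only at h
  simp only [snd_ite', fst_ite'] at h
  replace h := ite_eq_peel_ne (by decide) h
  replace h := ite_eq_peel_ne (by decide) h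
  replace h := ite_eq_peel_ne (by decide) h
  replace h := ite_eq_peel_ne (by decide) h
  -- ★(≥2, 2, 1): II*
  obtain ⟨hc, -⟩ | ⟨-, h⟩ := ite_eq_peel h
  · exact Or.inl ⟨hc.2.1, hc.2.2⟩
  replace h := ite_eq_peel_ne (by decide) h
  replace h := ite_eq_peel_ne (by decide) h
  replace h := ite_eq_peel_ne (by decide) h
  replace h := ite_eq_peel_ne (by decide) h
  replace h := ite_eq_peel_ne (by decide) h
  replace h := ite_eq_peel_ne (by decide) h
  -- (≥3, 4, 5): II
  obtain ⟨hc, -⟩ | ⟨-, h⟩ := ite_eq_peel h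
  · exact Or.inr (Or.inl ⟨hc.2.1, hc.2.2⟩)
  replace h := ite_eq_peel_ne (by decide) h
  replace h := ite_eq_peel_ne (by decide) h
  replace h := ite_eq_peel_ne (by decide) h
  -- (≥4, 5, 7): IV
  obtain ⟨hc, -⟩ | ⟨-, h⟩ := ite_eq_peel h
  · exact Or.inr (Or.inr (Or.inl ⟨hc.2.1, hc.2.2⟩))
  replace h := ite_eq_peel_ne (by decide) h
  replace h := ite_eq_peel_ne (by decide) h
  replace h := ite_eq_peel_ne (by decide) h
  replace h := ite_eq_peel_ne (by decide) h
  replace h := ite_eq_peel_ne (by decide) h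
  replace h := ite_eq_peel_ne (by decide) h
  replace h := ite_eq_peel_ne (by decide) h
  -- (≥5, 7, 11): IV*
  obtain ⟨hc, -⟩ | ⟨-, h⟩ := ite_eq_peel h
  · exact Or.inr (Or.inr (Or.inr ⟨hc.2.1, hc.2.2⟩))
  exact absurd h (by decide)

end Table

/-! ## §2 Table II read on invariants in the dicyclic windows: the shift solved for -/

section Invariants

/-- **`v(N) = 3` and `v₃Δ ∈ {3, 5, 9, 11}` ⟹ the Kraus middle entry**: `c₆ ≠ 0` and `(v₃c₆, v₃Δ)` is one of
`(3,3)`, `(4,3)` (then `c₄ ≠ 0`, `v₃c₄ = 2`), `(3,5)`, `(6,9)`, `(7,9)` (then `c₄ ≠ 0`, `v₃c₄ = 4`), `(6,11)`.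
The shift is `0` (`v₃Δ − 12m ∈ {3,5,9,11}`). [cite: Rizzo2003, Table II (p. 4) and §1.1–1.2 (pp. 3–4)] -/
theorem rows_of_condExpOfInvariants_eq_three {c₄ c₆ Δ : ℚ} (h : Rizzo.condExpOfInvariants c₄ c₆ Δ = 3)
    (hv : padicValRat 3 Δ = 3 ∨ padicValRat 3 Δ = 5 ∨ padicValRat 3 Δ = 9 ∨ padicValRat 3 Δ = 11) :
    c₆ ≠ 0 ∧
      ((padicValRat 3 c₆ = 3 ∧ padicValRat 3 Δ = 3) ∨
        (c₄ ≠ 0 ∧ padicValRat 3 c₄ = 2 ∧ padicValRat 3 c₆ = 4 ∧ padicValRat 3 Δ = 3) ∨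
        (padicValRat 3 c₆ = 3 ∧ padicValRat 3 Δ = 5) ∨
        (padicValRat 3 c₆ = 6 ∧ padicValRat 3 Δ = 9) ∨
        (c₄ ≠ 0 ∧ padicValRat 3 c₄ = 4 ∧ padicValRat 3 c₆ = 7 ∧ padicValRat 3 Δ = 9) ∨
        (padicValRat 3 c₆ = 6 ∧ padicValRat 3 Δ = 11)) := by
  unfold Rizzo.condExpOfInvariants Rizzo.ofInvariants at h
  dsimp only at h
  set m := KellockDokchitser.shift (padicValRat 3 Δ) (Rizzo.val3 c₆) (Rizzo.val3 c₄) with hm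
  clear_value m
  by_cases hc6 : c₆ = 0
  · have hv6 : Rizzo.val3 c₆ = ⊤ := by simp [Rizzo.val3, hc6]
    rw [hv6, WithTop.map_top] at h
    rcases rizzo_tableII_condExp_eq_three h with
      ⟨hb, -⟩ | ⟨-, hb, -⟩ | ⟨hb, -⟩ | ⟨hb, -⟩ | ⟨-, hb, -⟩ | ⟨hb, -⟩
    · exact absurd hb (WithTop.top_ne_ofNat 3)
    · exact absurd hb (WithTop.top_ne_ofNat 4)
    · exact absurd hb (WithTop.top_ne_ofNat 3)
    · exact absurd hb (WithTop.top_ne_ofNat 6)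
    · exact absurd hb (WithTop.top_ne_ofNat 7)
    · exact absurd hb (WithTop.top_ne_ofNat 6)
  have hv6 : Rizzo.val3 c₆ = ((padicValRat 3 c₆ : ℤ) : WithTop ℤ) := by simp [Rizzo.val3, hc6]
  rw [hv6, WithTop.map_coe] at h
  refine ⟨hc6, ?_⟩
  by_cases hc4 : c₄ = 0
  · have hv4 : Rizzo.val3 c₄ = ⊤ := by simp [Rizzo.val3, hc4]
    rw [hv4, WithTop.map_top] at h
    rcases rizzo_tableII_condExp_eq_three h with
      ⟨hb, hc⟩ | ⟨ha, -, -⟩ | ⟨hb, hc⟩ | ⟨hb, hc⟩ | ⟨ha, -, -⟩ | ⟨hb, hc⟩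
    · simp only [WithTop.coe_eq_ofNat] at hb
      exact Or.inl ⟨by omega, by omega⟩
    · exact absurd ha (WithTop.top_ne_ofNat 2)
    · simp only [WithTop.coe_eq_ofNat] at hb
      exact Or.inr (Or.inr (Or.inl ⟨by omega, by omega⟩))
    · simp only [WithTop.coe_eq_ofNat] at hb
      exact Or.inr (Or.inr (Or.inr (Or.inl ⟨by omega, by omega⟩)))
    · exact absurd ha (WithTop.top_ne_ofNat 4)
    · simp only [WithTop.coe_eq_ofNat] at hb
      exact Or.inr (Or.inr (Or.inr (Or.inr (Or.inr ⟨by omega, by omega⟩))))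
  have hv4 : Rizzo.val3 c₄ = ((padicValRat 3 c₄ : ℤ) : WithTop ℤ) := by simp [Rizzo.val3, hc4]
  rw [hv4, WithTop.map_coe] at h
  rcases rizzo_tableII_condExp_eq_three h with
    ⟨hb, hc⟩ | ⟨ha, hb, hc⟩ | ⟨hb, hc⟩ | ⟨hb, hc⟩ | ⟨ha, hb, hc⟩ | ⟨hb, hc⟩
  · simp only [WithTop.coe_eq_ofNat] at hb
    exact Or.inl ⟨by omega, by omega⟩
  · simp only [WithTop.coe_eq_ofNat] at ha hb
    exact Or.inr (Or.inl ⟨hc4, by omega, by omega, by omega⟩)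
  · simp only [WithTop.coe_eq_ofNat] at hb
    exact Or.inr (Or.inr (Or.inl ⟨by omega, by omega⟩))
  · simp only [WithTop.coe_eq_ofNat] at hb
    exact Or.inr (Or.inr (Or.inr (Or.inl ⟨by omega, by omega⟩)))
  · simp only [WithTop.coe_eq_ofNat] at ha hb
    exact Or.inr (Or.inr (Or.inr (Or.inr (Or.inl ⟨hc4, by omega, by omega, by omega⟩))))
  · simp only [WithTop.coe_eq_ofNat] at hb
    exact Or.inr (Or.inr (Or.inr (Or.inr (Or.inr ⟨by omega, by omega⟩))))

/-- **`v(N) = 5` and `v₃Δ ∈ {5, 7, 11, 13}` ⟹ the Kraus middle entry**: `c₆ ≠ 0` and `(v₃c₆, v₃Δ)` is one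
of `(8,13)` (the starred row, shift `1`), `(4,5)`, `(5,7)`, `(7,11)`. [cite: Rizzo2003, Table II (p. 4) and §1.1–1.2] -/
theorem rows_of_condExpOfInvariants_eq_five {c₄ c₆ Δ : ℚ} (h : Rizzo.condExpOfInvariants c₄ c₆ Δ = 5)
    (hv : padicValRat 3 Δ = 5 ∨ padicValRat 3 Δ = 7 ∨ padicValRat 3 Δ = 11 ∨ padicValRat 3 Δ = 13) :
    c₆ ≠ 0 ∧
      ((padicValRat 3 c₆ = 8 ∧ padicValRat 3 Δ = 13) ∨ (padicValRat 3 c₆ = 4 ∧ padicValRat 3 Δ = 5) ∨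
        (padicValRat 3 c₆ = 5 ∧ padicValRat 3 Δ = 7) ∨ (padicValRat 3 c₆ = 7 ∧ padicValRat 3 Δ = 11)) := by
  unfold Rizzo.condExpOfInvariants Rizzo.ofInvariants at h
  dsimp only at h
  set m := KellockDokchitser.shift (padicValRat 3 Δ) (Rizzo.val3 c₆) (Rizzo.val3 c₄) with hm
  clear_value m
  by_cases hc6 : c₆ = 0
  · have hv6 : Rizzo.val3 c₆ = ⊤ := by simp [Rizzo.val3, hc6]
    rw [hv6, WithTop.map_top] at h
    rcases rizzo_tableII_condExp_eq_five h with ⟨hb, -⟩ | ⟨hb, -⟩ | ⟨hb, -⟩ | ⟨hb, -⟩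
    · exact absurd hb (WithTop.top_ne_ofNat 2)
    · exact absurd hb (WithTop.top_ne_ofNat 4)
    · exact absurd hb (WithTop.top_ne_ofNat 5)
    · exact absurd hb (WithTop.top_ne_ofNat 7)
  have hv6 : Rizzo.val3 c₆ = ((padicValRat 3 c₆ : ℤ) : WithTop ℤ) := by simp [Rizzo.val3, hc6]
  rw [hv6, WithTop.map_coe] at h
  refine ⟨hc6, ?_⟩
  rcases rizzo_tableII_condExp_eq_five h with ⟨hb, hc⟩ | ⟨hb, hc⟩ | ⟨hb, hc⟩ | ⟨hb, hc⟩
  · simp only [WithTop.coe_eq_ofNat] at hb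
    exact Or.inl ⟨by omega, by omega⟩
  · simp only [WithTop.coe_eq_ofNat] at hb
    exact Or.inr (Or.inl ⟨by omega, by omega⟩)
  · simp only [WithTop.coe_eq_ofNat] at hb
    exact Or.inr (Or.inr (Or.inl ⟨by omega, by omega⟩))
  · simp only [WithTop.coe_eq_ofNat] at hb
    exact Or.inr (Or.inr (Or.inr ⟨by omega, by omega⟩))

end Invariants

end Summit.BirchSwinnertonDyer.BirchSwinnertonDyer.Theorems.PSLocalThreeTorsion

end
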